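import Literature.Probability.LatticeModels.IsingBoundaryMonotonicity
import Literature.Probability.LatticeModels.IsingConsistency
import HarnessLib

/-!
# The finite-volume Ising model with a site-dependent magnetic field

Topic `Probability/LatticeModels`. The tree's finite-volume Ising measure
`isingMeasure G Λ β h bc` (`IsingModel`, Friedli–Velenik 2017, §3.1) has a UNIFORM field `h ∈ ℝ`.
Correlation-inequality arguments that vary the field on part of the volume only — uniqueness in
a positive field via the GHS inequality and the convexity of the pressure (Friedli–Velenik 2017,
Remark 3.41 and Theorem 3.34; Preston 1974), inhomogeneous ("diluted") systems such as the
internal-spin systems of the Griffiths–Pearce–Israel argument (van Enter–Fernández–Sokal 1993,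
§4.3.1), and finite perturbations of the field — need the same model with a field
`h : V → ℝ` depending on the site: Hamiltonian
`ℋ^{bc}_{Λ;h}(σ) = -∑_{{x,y} ∈ ℰ^{bc}_Λ} σ_xσ_y - ∑_{x ∈ Λ} h_x σ_x` and Gibbs measure
`μ^{bc}_{Λ;β,h} ∝ e^{-β ℋ}` on the configurations glued to the boundary condition
(Friedli–Velenik 2017, §3.1 eq. (3.2) with `h ∑ σ_i` replaced by `∑ hᵢσᵢ`, as in their §3.8.1,
eq. (3.51): "`ℋ_{Λ;𝐉,𝐡}(ω) = -∑ J_{ij} σ_iσ_j - ∑_{i ∈ Λ} h_i σ_i`"; Georgii 2011, Ex. 2.12 with a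
non-constant external field). For a constant field it is literally the tree's model
(`fieldIsingMeasure_const`, `fieldExpect_const`).

## What is formalised (namespace `Literature.Probability.LatticeModels`)

* Definitions: `fieldHamiltonian`, `fieldIsingMeasure` (the tilt of the reference measure
  `isingRef Λ bc` by `e^{-βℋ}`, a probability measure), `fieldWeight`, `fieldZ` (partition
  function), `fieldExpect` (`⟨f⟩^{bc}_{Λ;β,h} = ∫ f dμ`), with the finite-sum formula
  `fieldExpect_eq_sum_div` and elementary API (linearity, monotonicity in `f`, positivity,
  bounds, constants).
* The FKG inequality `field_fkg` (Friedli–Velenik Thm. 3.21 for `ℋ_{Λ;𝐉,𝐡}`, `β ≥ 0`, ANY field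
  `h : V → ℝ` and any boundary condition), from the lattice condition and Mathlib's `fkg`,
  exactly as the tree's `ising_fkg_holds`.
* Global spin-flip symmetry for fixed boundary conditions: `fieldExpect_fixed_neg`,
  `⟨f⟩^{-η}_{Λ;β,-h} = ⟨f(-·)⟩^{η}_{Λ;β,h}` (Friedli–Velenik §3.7.1).
* Monotonicity in the field (`fieldExpect_mono_field`, FKG: `h₁ ≤ h₂` on `Λ` gives
  `⟨f⟩_{h₁} ≤ ⟨f⟩_{h₂}` for nondecreasing `f`, Friedli–Velenik §3.6.3 / Lemma 3.31) and in the
  boundary condition (`fieldExpect_fixed_mono`, `η₁ ≤ η₂` gives `⟨f⟩^{η₁} ≤ ⟨f⟩^{η₂}`,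
  Friedli–Velenik Exercise 3.13; the tilt factor is the tree's `bcTiltFactor` at zero field).

## References

* S. Friedli, Y. Velenik, *Statistical Mechanics of Lattice Systems* (CUP 2017), §3.1, §3.6.2–3,
  Thm. 3.21, Lemma 3.23, Exercise 3.13, §3.7.1, §3.8.1 eq. (3.51).
* H.-O. Georgii, *Gibbs Measures and Phase Transitions*, 2nd ed. (de Gruyter 2011), Ex. 2.12.
-/

noncomputable section

open MeasureTheory Finset

namespace Literature.Probability.LatticeModels

variable {V : Type*} (G : SimpleGraph V) [DecidableEq V] [G.LocallyFinite]

/-! ### Hamiltonian, Gibbs measure, weights, partition function, expectations -/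

/-- The finite-volume Ising Hamiltonian with a site-dependent field `h : V → ℝ` and boundary
condition `bc`: `ℋ^{bc}_{Λ;h}(σ) = -∑_{e ∈ ℰ^{bc}_Λ} σ_e - ∑_{x ∈ Λ} h_x σ_x`
(Friedli–Velenik 2017, §3.8.1 eq. (3.51) with `J ≡ 1`; eq. (3.2) for a constant field).
[cite: FriedliVelenik2017, §3.8.1 eq. (3.51)] -/
def fieldHamiltonian (Λ : Finset V) (h : V → ℝ) (bc : BoundaryCondition V) (σ : SpinConfig V) : ℝ :=
  -(∑ e ∈ interactionEdges G Λ bc, bondSpin σ e) - ∑ x ∈ Λ, h x * spinAt x σ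

/-- For a constant field the Hamiltonian is the tree's `isingHamiltonian`.
[cite: FriedliVelenik2017, §3.1 eq. (3.2)] -/
theorem fieldHamiltonian_const (Λ : Finset V) (h : ℝ) (bc : BoundaryCondition V) (σ : SpinConfig V) :
    fieldHamiltonian G Λ (fun _ => h) bc σ = isingHamiltonian G Λ h bc σ := by
  simp [fieldHamiltonian, isingHamiltonian, Finset.mul_sum]

/-- The Hamiltonian is measurable. [cite: FriedliVelenik2017, §6.2] -/
@[fun_prop]
theorem measurable_fieldHamiltonian (Λ : Finset V) (h : V → ℝ) (bc : BoundaryCondition V) :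
    Measurable (fieldHamiltonian G Λ h bc) := by
  unfold fieldHamiltonian
  refine Measurable.sub (Finset.measurable_sum _ fun e _ => measurable_bondSpin e).neg ?_
  exact Finset.measurable_sum _ fun x _ => (measurable_spinAt x).const_mul (h x)

/-- The finite-volume Gibbs measure `μ^{bc}_{Λ;β,h}` with site-dependent field: the reference
measure of the glued configurations tilted by `e^{-β ℋ^{bc}_{Λ;h}}`
(Friedli–Velenik 2017, §3.1 Def. 3.1 with the Hamiltonian (3.51)).
[cite: FriedliVelenik2017, §3.1 Def. 3.1 and §3.8.1 eq. (3.51)] -/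
def fieldIsingMeasure (Λ : Finset V) (β : ℝ) (h : V → ℝ) (bc : BoundaryCondition V) :
    Measure (SpinConfig V) :=
  (isingRef Λ bc).tilted fun σ => -β * fieldHamiltonian G Λ h bc σ

/-- For a constant field the measure is the tree's `isingMeasure`.
[cite: FriedliVelenik2017, §3.1 Def. 3.1] -/
theorem fieldIsingMeasure_const (Λ : Finset V) (β h : ℝ) (bc : BoundaryCondition V) :
    fieldIsingMeasure G Λ β (fun _ => h) bc = isingMeasure G Λ β h bc := by
  unfold fieldIsingMeasure isingMeasure
  congr 1
  funext σ
  rw [fieldHamiltonian_const]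

/-- The Boltzmann factor is integrable against the reference measure.
[cite: FriedliVelenik2017, §3.1] -/
theorem integrable_exp_fieldHamiltonian (Λ : Finset V) (β : ℝ) (h : V → ℝ) (bc : BoundaryCondition V) :
    Integrable (fun σ => Real.exp (-β * fieldHamiltonian G Λ h bc σ)) (isingRef Λ bc) := by
  have hm : Measurable fun σ => Real.exp (-β * fieldHamiltonian G Λ h bc σ) :=
    Real.measurable_exp.comp ((measurable_fieldHamiltonian G Λ h bc).const_mul _)
  rw [isingRef, integrable_map_measure hm.aestronglyMeasurable (measurable_glue Λ bc).aemeasurable]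
  exact Integrable.of_finite

/-- The finite-volume Gibbs measure is a probability measure. [cite: FriedliVelenik2017, §3.1] -/
instance fieldIsingMeasure.instIsProbabilityMeasure (Λ : Finset V) (β : ℝ) (h : V → ℝ)
    (bc : BoundaryCondition V) : IsProbabilityMeasure (fieldIsingMeasure G Λ β h bc) :=
  isProbabilityMeasure_tilted (integrable_exp_fieldHamiltonian G Λ β h bc)

/-- The Boltzmann weight `w(τ) = e^{-β ℋ(τ ∨ bc)}` of a finite configuration.
[cite: FriedliVelenik2017, §3.1 eq. (3.7)] -/
def fieldWeight (Λ : Finset V) (β : ℝ) (h : V → ℝ) (bc : BoundaryCondition V) (τ : Λ → ℤˣ) : ℝ :=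
  Real.exp (-β * fieldHamiltonian G Λ h bc (glue Λ τ bc))

/-- Weights are positive. [cite: FriedliVelenik2017, §3.1] -/
theorem fieldWeight_pos (Λ : Finset V) (β : ℝ) (h : V → ℝ) (bc : BoundaryCondition V)
    (τ : Λ → ℤˣ) : 0 < fieldWeight G Λ β h bc τ :=
  Real.exp_pos _

/-- For a constant field the weights are the tree's `isingWeight`. [cite: FriedliVelenik2017, §3.1 eq. (3.7)] -/
theorem fieldWeight_const (Λ : Finset V) (β h : ℝ) (bc : BoundaryCondition V) (τ : Λ → ℤˣ) :
    fieldWeight G Λ β (fun _ => h) bc τ = isingWeight G Λ β h bc τ := by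
  rw [fieldWeight, isingWeight, fieldHamiltonian_const]

/-- The partition function `Z^{bc}_{Λ;β,h} = ∑_τ w(τ)`. [cite: FriedliVelenik2017, §3.1 eq. (3.4)] -/
def fieldZ (Λ : Finset V) (β : ℝ) (h : V → ℝ) (bc : BoundaryCondition V) : ℝ :=
  ∑ τ : Λ → ℤˣ, fieldWeight G Λ β h bc τ

/-- The partition function is positive. [cite: FriedliVelenik2017, §3.1] -/
theorem fieldZ_pos (Λ : Finset V) (β : ℝ) (h : V → ℝ) (bc : BoundaryCondition V) :
    0 < fieldZ G Λ β h bc :=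
  Finset.sum_pos (fun τ _ => fieldWeight_pos G Λ β h bc τ) Finset.univ_nonempty

/-- For a constant field the partition function is the tree's. [cite: FriedliVelenik2017, §3.1 eq. (3.4)] -/
theorem fieldZ_const (Λ : Finset V) (β h : ℝ) (bc : BoundaryCondition V) :
    fieldZ G Λ β (fun _ => h) bc = isingPartitionFunction G Λ β h bc := by
  simp [fieldZ, isingPartitionFunction, fieldWeight_const]

/-- The normalising integral is the partition function. [cite: FriedliVelenik2017, §3.1] -/
theorem integral_exp_isingRef_field (Λ : Finset V) (β : ℝ) (h : V → ℝ) (bc : BoundaryCondition V) :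
    ∫ σ, Real.exp (-β * fieldHamiltonian G Λ h bc σ) ∂isingRef Λ bc = fieldZ G Λ β h bc := by
  have hm : Measurable fun σ => Real.exp (-β * fieldHamiltonian G Λ h bc σ) :=
    Real.measurable_exp.comp ((measurable_fieldHamiltonian G Λ h bc).const_mul _)
  rw [isingRef, integral_map (measurable_glue Λ bc).aemeasurable hm.aestronglyMeasurable,
    integral_fintype Integrable.of_finite]
  simp [fieldZ, fieldWeight]

/-- **Expectations are finite Boltzmann-weighted averages**:
`∫ f dμ^{bc}_{Λ;β,h} = (∑_τ w(τ) f(τ ∨ bc)) / Z` for measurable `f`.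
[cite: FriedliVelenik2017, §3.1 eq. (3.8)] -/
theorem integral_fieldIsingMeasure (Λ : Finset V) (β : ℝ) (h : V → ℝ) (bc : BoundaryCondition V)
    {f : SpinConfig V → ℝ} (hf : Measurable f) :
    ∫ σ, f σ ∂fieldIsingMeasure G Λ β h bc =
      (∑ τ : Λ → ℤˣ, fieldWeight G Λ β h bc τ * f (glue Λ τ bc)) / fieldZ G Λ β h bc := by
  have hm : Measurable fun σ => Real.exp (-β * fieldHamiltonian G Λ h bc σ) :=
    Real.measurable_exp.comp ((measurable_fieldHamiltonian G Λ h bc).const_mul _)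
  have hm' : Measurable fun σ =>
      (Real.exp (-β * fieldHamiltonian G Λ h bc σ) / fieldZ G Λ β h bc) • f σ :=
    (hm.div_const _).smul hf
  rw [fieldIsingMeasure, integral_tilted, integral_exp_isingRef_field, isingRef,
    integral_map (measurable_glue Λ bc).aemeasurable hm'.aestronglyMeasurable]
  simp only [smul_eq_mul]
  rw [integral_fintype Integrable.of_finite, Finset.sum_div]
  refine Finset.sum_congr rfl fun τ _ => ?_
  simp only [count_real_singleton, fieldWeight]
  ring

/-- The Gibbs expectation `⟨f⟩^{bc}_{Λ;β,h} = ∫ f dμ^{bc}_{Λ;β,h}`. [cite: FriedliVelenik2017, §3.1 eq. (3.8)] -/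
def fieldExpect (Λ : Finset V) (β : ℝ) (h : V → ℝ) (bc : BoundaryCondition V)
    (f : SpinConfig V → ℝ) : ℝ :=
  ∫ σ, f σ ∂fieldIsingMeasure G Λ β h bc

/-- For a constant field the expectation is the tree's `isingExpect`. [cite: FriedliVelenik2017, §3.1 eq. (3.8)] -/
theorem fieldExpect_const (Λ : Finset V) (β h : ℝ) (bc : BoundaryCondition V)
    (f : SpinConfig V → ℝ) :
    fieldExpect G Λ β (fun _ => h) bc f = isingExpect G Λ β h bc f := by
  rw [fieldExpect, isingExpect, fieldIsingMeasure_const]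

/-- The finite-sum formula for `⟨f⟩^{bc}_{Λ;β,h}`. [cite: FriedliVelenik2017, §3.1 eq. (3.8)] -/
theorem fieldExpect_eq_sum_div (Λ : Finset V) (β : ℝ) (h : V → ℝ) (bc : BoundaryCondition V)
    {f : SpinConfig V → ℝ} (hf : Measurable f) :
    fieldExpect G Λ β h bc f =
      (∑ τ : Λ → ℤˣ, fieldWeight G Λ β h bc τ * f (glue Λ τ bc)) / fieldZ G Λ β h bc :=
  integral_fieldIsingMeasure G Λ β h bc hf

/-- Expectation of a constant. [folklore] -/
@[simp] theorem fieldExpect_const_fun (Λ : Finset V) (β : ℝ) (h : V → ℝ) (bc : BoundaryCondition V)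
    (c : ℝ) : fieldExpect G Λ β h bc (fun _ => c) = c := by
  simp [fieldExpect]

/-- Additivity. [folklore] -/
theorem fieldExpect_add (Λ : Finset V) (β : ℝ) (h : V → ℝ) (bc : BoundaryCondition V)
    {f g : SpinConfig V → ℝ} (hf : Measurable f) (hg : Measurable g) :
    fieldExpect G Λ β h bc (fun σ => f σ + g σ) =
      fieldExpect G Λ β h bc f + fieldExpect G Λ β h bc g := by
  rw [fieldExpect_eq_sum_div G Λ β h bc (show Measurable (fun σ => f σ + g σ) from hf.add hg),
    fieldExpect_eq_sum_div G Λ β h bc hf,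
    fieldExpect_eq_sum_div G Λ β h bc hg, ← add_div, ← Finset.sum_add_distrib]
  simp only [mul_add]

/-- Homogeneity. [folklore] -/
theorem fieldExpect_const_mul (Λ : Finset V) (β : ℝ) (h : V → ℝ) (bc : BoundaryCondition V)
    (c : ℝ) {f : SpinConfig V → ℝ} (hf : Measurable f) :
    fieldExpect G Λ β h bc (fun σ => c * f σ) = c * fieldExpect G Λ β h bc f := by
  rw [fieldExpect_eq_sum_div G Λ β h bc (show Measurable (fun σ => c * f σ) from hf.const_mul c),
    fieldExpect_eq_sum_div G Λ β h bc hf, mul_div_assoc', Finset.mul_sum]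
  congr 1
  exact Finset.sum_congr rfl fun τ _ => by ring

/-- Subtraction. [folklore] -/
theorem fieldExpect_sub (Λ : Finset V) (β : ℝ) (h : V → ℝ) (bc : BoundaryCondition V)
    {f g : SpinConfig V → ℝ} (hf : Measurable f) (hg : Measurable g) :
    fieldExpect G Λ β h bc (fun σ => f σ - g σ) =
      fieldExpect G Λ β h bc f - fieldExpect G Λ β h bc g := by
  rw [fieldExpect_eq_sum_div G Λ β h bc (show Measurable (fun σ => f σ - g σ) from hf.sub hg),
    fieldExpect_eq_sum_div G Λ β h bc hf,
    fieldExpect_eq_sum_div G Λ β h bc hg, ← sub_div, ← Finset.sum_sub_distrib]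
  simp only [mul_sub]

/-- Finite additivity. [folklore] -/
theorem fieldExpect_finset_sum {ι : Type*} (Λ : Finset V) (β : ℝ) (h : V → ℝ)
    (bc : BoundaryCondition V) (s : Finset ι) (f : ι → SpinConfig V → ℝ)
    (hf : ∀ i, Measurable (f i)) :
    fieldExpect G Λ β h bc (fun σ => ∑ i ∈ s, f i σ) = ∑ i ∈ s, fieldExpect G Λ β h bc (f i) := by
  classical
  induction s using Finset.induction_on with
  | empty => simp
  | insert i s hi ih =>
    simp only [Finset.sum_insert hi]
    rw [fieldExpect_add G Λ β h bc (hf i) (Finset.measurable_sum _ fun j _ => hf j), ih]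

/-- Monotonicity in the observable. [folklore] -/
theorem fieldExpect_mono_fun (Λ : Finset V) (β : ℝ) (h : V → ℝ) (bc : BoundaryCondition V)
    {f g : SpinConfig V → ℝ} (hf : Measurable f) (hg : Measurable g) (hle : ∀ σ, f σ ≤ g σ) :
    fieldExpect G Λ β h bc f ≤ fieldExpect G Λ β h bc g := by
  rw [fieldExpect_eq_sum_div G Λ β h bc hf, fieldExpect_eq_sum_div G Λ β h bc hg]
  refine div_le_div_of_nonneg_right (Finset.sum_le_sum fun τ _ => ?_) (fieldZ_pos G Λ β h bc).le
  exact mul_le_mul_of_nonneg_left (hle _) (fieldWeight_pos G Λ β h bc τ).le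

/-- Positivity for positive observables. [folklore] -/
theorem fieldExpect_pos (Λ : Finset V) (β : ℝ) (h : V → ℝ) (bc : BoundaryCondition V)
    {f : SpinConfig V → ℝ} (hf : Measurable f) (hpos : ∀ σ, 0 < f σ) :
    0 < fieldExpect G Λ β h bc f := by
  rw [fieldExpect_eq_sum_div G Λ β h bc hf]
  exact div_pos (Finset.sum_pos (fun τ _ => mul_pos (fieldWeight_pos G Λ β h bc τ) (hpos _))
    Finset.univ_nonempty) (fieldZ_pos G Λ β h bc)

/-- Nonnegativity for nonnegative observables. [folklore] -/
theorem fieldExpect_nonneg (Λ : Finset V) (β : ℝ) (h : V → ℝ) (bc : BoundaryCondition V)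
    {f : SpinConfig V → ℝ} (hf : Measurable f) (hnn : ∀ σ, 0 ≤ f σ) :
    0 ≤ fieldExpect G Λ β h bc f := by
  rw [fieldExpect_eq_sum_div G Λ β h bc hf]
  exact div_nonneg (Finset.sum_nonneg fun τ _ => mul_nonneg (fieldWeight_pos G Λ β h bc τ).le
    (hnn _)) (fieldZ_pos G Λ β h bc).le

/-- `‖⟨f⟩‖ ≤ C` when `‖f‖ ≤ C`. [cite: FriedliVelenik2017, §3.1 eq. (3.8)] -/
theorem norm_fieldExpect_le (Λ : Finset V) (β : ℝ) (h : V → ℝ) (bc : BoundaryCondition V)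
    {f : SpinConfig V → ℝ} {C : ℝ} (hC : ∀ σ, ‖f σ‖ ≤ C) : ‖fieldExpect G Λ β h bc f‖ ≤ C := by
  unfold fieldExpect
  simpa using norm_integral_le_of_norm_le_const (μ := fieldIsingMeasure G Λ β h bc) (ae_of_all _ hC)

/-- `|⟨f⟩| ≤ C` when `|f| ≤ C`. [cite: FriedliVelenik2017, §3.1 eq. (3.8)] -/
theorem abs_fieldExpect_le (Λ : Finset V) (β : ℝ) (h : V → ℝ) (bc : BoundaryCondition V)
    {f : SpinConfig V → ℝ} {C : ℝ} (hC : ∀ σ, |f σ| ≤ C) : |fieldExpect G Λ β h bc f| ≤ C := by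
  have := norm_fieldExpect_le G Λ β h bc (f := f) (C := C) (fun σ => by
    rw [Real.norm_eq_abs]; exact hC σ)
  rwa [Real.norm_eq_abs] at this

/-- The weights and the partition function depend on `h` only through its values on `Λ`.
[cite: FriedliVelenik2017, §3.1 eq. (3.2)] -/
theorem fieldHamiltonian_congr {Λ : Finset V} {h₁ h₂ : V → ℝ} (hh : ∀ x ∈ Λ, h₁ x = h₂ x)
    (bc : BoundaryCondition V) (σ : SpinConfig V) :
    fieldHamiltonian G Λ h₁ bc σ = fieldHamiltonian G Λ h₂ bc σ := by
  unfold fieldHamiltonian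
  congr 1
  exact Finset.sum_congr rfl fun x hx => by rw [hh x hx]

/-- Expectations depend on `h` only through its values on `Λ`. [cite: FriedliVelenik2017, §3.1 eq. (3.2)] -/
theorem fieldExpect_congr_field {Λ : Finset V} (β : ℝ) {h₁ h₂ : V → ℝ} (hh : ∀ x ∈ Λ, h₁ x = h₂ x)
    (bc : BoundaryCondition V) (f : SpinConfig V → ℝ) :
    fieldExpect G Λ β h₁ bc f = fieldExpect G Λ β h₂ bc f := by
  unfold fieldExpect fieldIsingMeasure
  congr 2
  funext σ
  rw [fieldHamiltonian_congr G hh]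

/-! ### The FKG inequality -/

/-- **The energy is supermodular** (Friedli–Velenik 2017, §3.8.3: the model (3.51) satisfies
the FKG lattice condition for any field): `-ℋ(σ) - ℋ(σ') ≤ -ℋ(σ ∧ σ') - ℋ(σ ∨ σ')`.
[cite: FriedliVelenik2017, §3.8.3] -/
theorem neg_fieldHamiltonian_supermodular (Λ : Finset V) (h : V → ℝ) (bc : BoundaryCondition V)
    (σ σ' : SpinConfig V) :
    -fieldHamiltonian G Λ h bc σ + -fieldHamiltonian G Λ h bc σ' ≤
      -fieldHamiltonian G Λ h bc (σ ⊓ σ') + -fieldHamiltonian G Λ h bc (σ ⊔ σ') := by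
  have hE : ∑ e ∈ interactionEdges G Λ bc, bondSpin σ e + ∑ e ∈ interactionEdges G Λ bc, bondSpin σ' e ≤
      ∑ e ∈ interactionEdges G Λ bc, bondSpin (σ ⊓ σ') e +
        ∑ e ∈ interactionEdges G Λ bc, bondSpin (σ ⊔ σ') e := by
    rw [← Finset.sum_add_distrib, ← Finset.sum_add_distrib]
    exact Finset.sum_le_sum fun e _ => bondSpin_supermodular e σ σ'
  have hS : ∑ x ∈ Λ, h x * spinAt x σ + ∑ x ∈ Λ, h x * spinAt x σ' =
      ∑ x ∈ Λ, h x * spinAt x (σ ⊓ σ') + ∑ x ∈ Λ, h x * spinAt x (σ ⊔ σ') := by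
    rw [← Finset.sum_add_distrib, ← Finset.sum_add_distrib]
    refine Finset.sum_congr rfl fun x _ => ?_
    rw [← mul_add, ← mul_add, spinAt_add_modular x σ σ']
  simp only [fieldHamiltonian, neg_sub, sub_neg_eq_add]
  linarith

/-- **The FKG lattice condition** (Friedli–Velenik 2017, eq. (3.53)): for `β ≥ 0`,
`w(τ) w(τ') ≤ w(τ ∧ τ') w(τ ∨ τ')`. [cite: FriedliVelenik2017, §3.8.3, eq. (3.53)] -/
theorem fieldWeight_lattice_condition (Λ : Finset V) {β : ℝ} (hβ : 0 ≤ β) (h : V → ℝ)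
    (bc : BoundaryCondition V) (τ τ' : Λ → ℤˣ) :
    fieldWeight G Λ β h bc τ * fieldWeight G Λ β h bc τ' ≤
      fieldWeight G Λ β h bc (τ ⊓ τ') * fieldWeight G Λ β h bc (τ ⊔ τ') := by
  simp only [fieldWeight, ← Real.exp_add, glue_inf, glue_sup]
  refine Real.exp_le_exp.2 ?_
  have := neg_fieldHamiltonian_supermodular G Λ h bc (glue Λ τ bc) (glue Λ τ' bc)
  nlinarith

/-- **The FKG inequality** (Fortuin–Kasteleyn–Ginibre 1971; Friedli–Velenik 2017, Thm. 3.21,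
for the Hamiltonian (3.51)): for `β ≥ 0`, any site-dependent field `h`, any boundary condition and
nondecreasing measurable `f, g`, `⟨f⟩⟨g⟩ ≤ ⟨f g⟩`. From the lattice condition and Mathlib's
abstract `fkg` on the distributive lattice `{−1,+1}^Λ`, as the tree's `ising_fkg_holds`.
[cite: FriedliVelenik2017, Thm. 3.21] -/
theorem field_fkg {β : ℝ} (hβ : 0 ≤ β) (Λ : Finset V) (h : V → ℝ) (bc : BoundaryCondition V)
    (f g : SpinConfig V → ℝ) (hf : Monotone f) (hg : Monotone g) (hfm : Measurable f)
    (hgm : Measurable g) :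
    fieldExpect G Λ β h bc f * fieldExpect G Λ β h bc g ≤ fieldExpect G Λ β h bc (f * g) := by
  classical
  set w : (Λ → ℤˣ) → ℝ := fieldWeight G Λ β h bc with hw
  set F : (Λ → ℤˣ) → ℝ := fun τ => f (glue Λ τ bc) with hF
  set Gg : (Λ → ℤˣ) → ℝ := fun τ => g (glue Λ τ bc) with hGg
  have hFm : Monotone F := fun τ τ' hle => hf (glue_monotone Λ bc hle)
  have hGm : Monotone Gg := fun τ τ' hle => hg (glue_monotone Λ bc hle)
  set C₁ : ℝ := ∑ τ, |F τ| with hC₁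
  set C₂ : ℝ := ∑ τ, |Gg τ| with hC₂
  have hF0 : 0 ≤ fun τ => F τ + C₁ := fun τ => by
    have h1 : |F τ| ≤ C₁ :=
      Finset.single_le_sum (f := fun τ => |F τ|) (fun _ _ => abs_nonneg _) (Finset.mem_univ τ)
    simp only [Pi.zero_apply]
    linarith [neg_abs_le (F τ)]
  have hG0 : 0 ≤ fun τ => Gg τ + C₂ := fun τ => by
    have h1 : |Gg τ| ≤ C₂ :=
      Finset.single_le_sum (f := fun τ => |Gg τ|) (fun _ _ => abs_nonneg _) (Finset.mem_univ τ)
    simp only [Pi.zero_apply]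
    linarith [neg_abs_le (Gg τ)]
  have hw0 : 0 ≤ w := fun τ => (fieldWeight_pos G Λ β h bc τ).le
  have key := fkg (fun τ => F τ + C₁) (fun τ => Gg τ + C₂) w hw0 hF0 hG0
    (hFm.add_const C₁) (hGm.add_const C₂)
    (fun a b => fieldWeight_lattice_condition G Λ hβ h bc a b)
  set Z : ℝ := ∑ τ, w τ with hZdef
  set Sf : ℝ := ∑ τ, w τ * F τ with hSf
  set Sg : ℝ := ∑ τ, w τ * Gg τ with hSg
  set Sfg : ℝ := ∑ τ, w τ * (F τ * Gg τ) with hSfg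
  have hZ : 0 < Z := Finset.sum_pos (fun τ _ => fieldWeight_pos G Λ β h bc τ) Finset.univ_nonempty
  have e1 : ∑ τ, w τ * (F τ + C₁) = Sf + C₁ * Z := by
    simp only [mul_add, Finset.sum_add_distrib, hSf, hZdef, Finset.mul_sum]
    congr 1
    exact Finset.sum_congr rfl fun τ _ => by ring
  have e2 : ∑ τ, w τ * (Gg τ + C₂) = Sg + C₂ * Z := by
    simp only [mul_add, Finset.sum_add_distrib, hSg, hZdef, Finset.mul_sum]
    congr 1
    exact Finset.sum_congr rfl fun τ _ => by ring
  have e3 : ∑ τ, w τ * ((F τ + C₁) * (Gg τ + C₂)) = Sfg + C₂ * Sf + C₁ * Sg + C₁ * C₂ * Z := by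
    simp only [hSfg, hSf, hSg, hZdef, Finset.mul_sum, ← Finset.sum_add_distrib]
    exact Finset.sum_congr rfl fun τ _ => by ring
  rw [e1, e2, e3] at key
  have hmain : Sf * Sg ≤ Sfg * Z := by nlinarith
  have hexpF : fieldExpect G Λ β h bc f = Sf / Z := by
    rw [fieldExpect_eq_sum_div G Λ β h bc hfm]; rfl
  have hexpG : fieldExpect G Λ β h bc g = Sg / Z := by
    rw [fieldExpect_eq_sum_div G Λ β h bc hgm]; rfl
  have hexpFG : fieldExpect G Λ β h bc (f * g) = Sfg / Z := by
    rw [fieldExpect_eq_sum_div G Λ β h bc (hfm.mul hgm)]; rfl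
  rw [hexpF, hexpG, hexpFG, div_mul_div_comm, div_le_div_iff₀ (mul_pos hZ hZ) hZ]
  nlinarith [mul_le_mul_of_nonneg_right hmain hZ.le]

/-! ### Global spin-flip symmetry (fixed boundary conditions) -/

omit [DecidableEq V] [G.LocallyFinite] in
/-- `σ_e(-σ) = σ_e(σ)` for every bond. [cite: FriedliVelenik2017, §3.7.1] -/
theorem bondSpin_neg (σ : SpinConfig V) (e : Sym2 V) : bondSpin (-σ) e = bondSpin σ e := by
  induction e using Sym2.ind with
  | _ u v => simp [bondSpin_mk, spinAt_neg]

/-- The Hamiltonian is invariant under the global flip `(σ, h, η) ↦ (-σ, -h, -η)`.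
[cite: FriedliVelenik2017, §3.7.1] -/
theorem fieldHamiltonian_fixed_neg (Λ : Finset V) (h : V → ℝ) (η σ : SpinConfig V) :
    fieldHamiltonian G Λ (-h) (.fixed (-η)) (-σ) = fieldHamiltonian G Λ h (.fixed η) σ := by
  simp only [fieldHamiltonian, interactionEdges_fixed, bondSpin_neg, spinAt_neg, Pi.neg_apply,
    neg_mul_neg]

/-- The weights are invariant under the global flip. [cite: FriedliVelenik2017, §3.7.1] -/
theorem fieldWeight_fixed_neg (Λ : Finset V) (β : ℝ) (h : V → ℝ) (η : SpinConfig V) (τ : Λ → ℤˣ) :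
    fieldWeight G Λ β (-h) (.fixed (-η)) (-τ) = fieldWeight G Λ β h (.fixed η) τ := by
  rw [fieldWeight, fieldWeight, glue_neg_fixed, fieldHamiltonian_fixed_neg]

/-- The partition function is invariant under the global flip. [cite: FriedliVelenik2017, §3.7.1] -/
theorem fieldZ_fixed_neg (Λ : Finset V) (β : ℝ) (h : V → ℝ) (η : SpinConfig V) :
    fieldZ G Λ β (-h) (.fixed (-η)) = fieldZ G Λ β h (.fixed η) := by
  unfold fieldZ
  rw [← Equiv.sum_comp (Equiv.neg (Λ → ℤˣ))]
  exact Finset.sum_congr rfl fun τ _ => by rw [Equiv.neg_apply, fieldWeight_fixed_neg]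

omit [DecidableEq V] [G.LocallyFinite] in
/-- The global spin flip is measurable. [cite: FriedliVelenik2017, §6.2] -/
theorem measurable_neg_spinConfig' : Measurable fun σ : SpinConfig V => -σ :=
  measurable_pi_lambda _ fun x =>
    (measurable_of_countable fun u : ℤˣ => -u).comp (measurable_pi_apply x)

/-- **Global spin-flip symmetry** (Friedli–Velenik 2017, §3.7.1):
`⟨f⟩^{-η}_{Λ;β,-h} = ⟨f(-·)⟩^{η}_{Λ;β,h}`. [cite: FriedliVelenik2017, §3.7.1] -/
theorem fieldExpect_fixed_neg (Λ : Finset V) (β : ℝ) (h : V → ℝ) (η : SpinConfig V)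
    {f : SpinConfig V → ℝ} (hf : Measurable f) :
    fieldExpect G Λ β (-h) (.fixed (-η)) f = fieldExpect G Λ β h (.fixed η) (fun σ => f (-σ)) := by
  have hfn : Measurable fun σ : SpinConfig V => f (-σ) := hf.comp measurable_neg_spinConfig'
  rw [fieldExpect_eq_sum_div G Λ β _ _ hf, fieldExpect_eq_sum_div G Λ β _ _ hfn, fieldZ_fixed_neg]
  congr 1
  rw [← Equiv.sum_comp (Equiv.neg (Λ → ℤˣ))]
  refine Finset.sum_congr rfl fun τ _ => ?_
  rw [Equiv.neg_apply, fieldWeight_fixed_neg, glue_neg_fixed]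

/-! ### Tilting identities; monotonicity in the field and in the boundary condition -/

/-- **The tilting identity**: if the weights of `(h₂, bc₂)` are those of `(h₁, bc₁)` times
`R(τ ∨ bc₁)`, the two boundary conditions gluing identically, then `⟨f⟩₂ = ⟨f R⟩₁ / ⟨R⟩₁`.
[cite: FriedliVelenik2017, §3.6.3, proof of Lemma 3.23] -/
theorem fieldExpect_eq_div_of_weight_eq {Λ : Finset V} {β : ℝ} {h₁ h₂ : V → ℝ}
    {bc₁ bc₂ : BoundaryCondition V} (hout : bc₁.outside = bc₂.outside)
    {R : SpinConfig V → ℝ} (hR : Measurable R)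
    (hw : ∀ τ : Λ → ℤˣ, fieldWeight G Λ β h₂ bc₂ τ = fieldWeight G Λ β h₁ bc₁ τ * R (glue Λ τ bc₁))
    {f : SpinConfig V → ℝ} (hf : Measurable f) :
    fieldExpect G Λ β h₂ bc₂ f =
      fieldExpect G Λ β h₁ bc₁ (fun σ => f σ * R σ) / fieldExpect G Λ β h₁ bc₁ R := by
  have hZ₁ := fieldZ_pos G Λ β h₁ bc₁
  rw [fieldExpect_eq_sum_div G Λ β h₂ bc₂ hf,
    fieldExpect_eq_sum_div G Λ β h₁ bc₁ (f := fun σ => f σ * R σ) (hf.mul hR),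
    fieldExpect_eq_sum_div G Λ β h₁ bc₁ hR, div_div_div_cancel_right₀ hZ₁.ne']
  have hZ₂ : fieldZ G Λ β h₂ bc₂ = ∑ τ : Λ → ℤˣ, fieldWeight G Λ β h₁ bc₁ τ * R (glue Λ τ bc₁) := by
    simp only [fieldZ, hw]
  rw [hZ₂]
  congr 1
  refine Finset.sum_congr rfl fun τ _ => ?_
  rw [hw τ, ← glue_eq_of_outside_eq hout Λ τ]
  ring

/-- **The field tilt**: `w_{h₂}(τ) = w_{h₁}(τ) · exp(β ∑_{x∈Λ} (h₂-h₁)_x σ_x(τ ∨ bc))`.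
[cite: FriedliVelenik2017, §3.6.3] -/
theorem fieldWeight_field_tilt (Λ : Finset V) (β : ℝ) (h₁ h₂ : V → ℝ) (bc : BoundaryCondition V)
    (τ : Λ → ℤˣ) :
    fieldWeight G Λ β h₂ bc τ = fieldWeight G Λ β h₁ bc τ *
      Real.exp (β * ∑ x ∈ Λ, (h₂ x - h₁ x) * spinAt x (glue Λ τ bc)) := by
  rw [fieldWeight, fieldWeight, ← Real.exp_add]
  congr 1
  simp only [fieldHamiltonian, sub_mul, Finset.sum_sub_distrib]
  ring

/-- **Monotonicity in the field** (Friedli–Velenik 2017, §3.6.3 / Lemma 3.31 (1), from FKG): for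
`β ≥ 0`, `h₁ ≤ h₂` on `Λ`, any boundary condition and nondecreasing measurable `f`,
`⟨f⟩^{bc}_{Λ;β,h₁} ≤ ⟨f⟩^{bc}_{Λ;β,h₂}`. [cite: FriedliVelenik2017, Lemma 3.31 (1)] -/
theorem fieldExpect_mono_field {β : ℝ} (hβ : 0 ≤ β) {Λ : Finset V} {h₁ h₂ : V → ℝ}
    (hh : ∀ x ∈ Λ, h₁ x ≤ h₂ x) (bc : BoundaryCondition V) {f : SpinConfig V → ℝ}
    (hf : Monotone f) (hfm : Measurable f) :
    fieldExpect G Λ β h₁ bc f ≤ fieldExpect G Λ β h₂ bc f := by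
  set R : SpinConfig V → ℝ := fun σ => Real.exp (β * ∑ x ∈ Λ, (h₂ x - h₁ x) * spinAt x σ) with hRdef
  have hR : Measurable R := Real.measurable_exp.comp
    ((Finset.measurable_sum _ fun x _ => (measurable_spinAt x).const_mul _).const_mul _)
  have hRmono : Monotone R := fun σ σ' hle =>
    Real.exp_le_exp.2 (mul_le_mul_of_nonneg_left (Finset.sum_le_sum fun x hx =>
      mul_le_mul_of_nonneg_left (spinAt_mono x hle) (sub_nonneg.2 (hh x hx))) hβ)
  have hRpos : ∀ σ, 0 < R σ := fun σ => Real.exp_pos _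
  rw [fieldExpect_eq_div_of_weight_eq G rfl hR (fieldWeight_field_tilt G Λ β h₁ h₂ bc) hfm,
    le_div_iff₀ (fieldExpect_pos G Λ β h₁ bc hR hRpos)]
  exact field_fkg G hβ Λ h₁ bc f R hf hRmono hfm hR

/-- **The boundary tilt**: the `η₂`-weights are the `η₁`-weights times the tree's tilt factor
`bcTiltFactor G Λ β 0 η₁ η₂` (the field terms of the two Hamiltonians coincide on re-glued
configurations). [cite: FriedliVelenik2017, proof of Lemma 3.23 and Exercise 3.13] -/
theorem fieldWeight_fixed_eq_mul_bcTiltFactor (Λ : Finset V) (β : ℝ) (h : V → ℝ)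
    (η₁ η₂ : SpinConfig V) (τ : Λ → ℤˣ) :
    fieldWeight G Λ β h (.fixed η₂) τ =
      fieldWeight G Λ β h (.fixed η₁) τ * bcTiltFactor G Λ β 0 η₁ η₂ (glue Λ τ (.fixed η₁)) := by
  rw [fieldWeight, fieldWeight, bcTiltFactor, ← Real.exp_add, reglue_glue, reglue_glue]
  congr 1
  have hfield : ∑ x ∈ Λ, h x * spinAt x (glue Λ τ (.fixed η₂)) =
      ∑ x ∈ Λ, h x * spinAt x (glue Λ τ (.fixed η₁)) :=
    Finset.sum_congr rfl fun x hx => by simp [spinAt, glue_apply_of_mem _ _ _ hx]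
  simp only [fieldHamiltonian, isingHamiltonian, interactionEdges_fixed, zero_mul, sub_zero, hfield]
  ring

/-- `⟨R_{η₁→η₂}⟩^{η₁}_{Λ;β,h} = Z^{η₂}_{Λ;β,h}/Z^{η₁}_{Λ;β,h}`. [cite: FriedliVelenik2017, proof of Lemma 3.23] -/
theorem fieldExpect_bcTiltFactor (Λ : Finset V) (β : ℝ) (h : V → ℝ) (η₁ η₂ : SpinConfig V) :
    fieldExpect G Λ β h (.fixed η₁) (bcTiltFactor G Λ β 0 η₁ η₂) =
      fieldZ G Λ β h (.fixed η₂) / fieldZ G Λ β h (.fixed η₁) := by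
  rw [fieldExpect_eq_sum_div G Λ β h _ (measurable_bcTiltFactor G Λ β 0 η₁ η₂)]
  congr 1
  simp only [fieldZ]
  refine Finset.sum_congr rfl fun τ _ => ?_
  rw [fieldWeight_fixed_eq_mul_bcTiltFactor G Λ β h η₁ η₂ τ]

/-- **Monotonicity in the boundary condition** (Friedli–Velenik 2017, Exercise 3.13, for the
Hamiltonian (3.51)): for `β ≥ 0`, any field `h : V → ℝ`, boundary conditions `η₁ ≤ η₂` and
nondecreasing measurable `f`, `⟨f⟩^{η₁}_{Λ;β,h} ≤ ⟨f⟩^{η₂}_{Λ;β,h}` — as the tree's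
`isingExpect_fixed_mono`: `f(τ·η₂) ≥ f(τ·η₁)`, the tilt identity and FKG for the nondecreasing
tilt factor. [cite: FriedliVelenik2017, Exercise 3.13] -/
theorem fieldExpect_fixed_mono {β : ℝ} (hβ : 0 ≤ β) (Λ : Finset V) (h : V → ℝ)
    {η₁ η₂ : SpinConfig V} (hη : η₁ ≤ η₂) {f : SpinConfig V → ℝ} (hf : Monotone f)
    (hfm : Measurable f) :
    fieldExpect G Λ β h (.fixed η₁) f ≤ fieldExpect G Λ β h (.fixed η₂) f := by
  set R : SpinConfig V → ℝ := bcTiltFactor G Λ β 0 η₁ η₂ with hRdef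
  have hR : Measurable R := measurable_bcTiltFactor G Λ β 0 η₁ η₂
  have hRmono : Monotone R := bcTiltFactor_mono G Λ hβ 0 hη
  have hZ₂ := fieldZ_pos G Λ β h (.fixed η₂)
  have hZ₁ := fieldZ_pos G Λ β h (.fixed η₁)
  -- Step 1: replace `f(τ·η₂)` by the smaller `f(τ·η₁)` in the `η₂`-average
  have step1 : (∑ τ : Λ → ℤˣ, fieldWeight G Λ β h (.fixed η₂) τ * f (glue Λ τ (.fixed η₁))) /
      fieldZ G Λ β h (.fixed η₂) ≤ fieldExpect G Λ β h (.fixed η₂) f := by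
    rw [fieldExpect_eq_sum_div G Λ β h _ hfm]
    refine div_le_div_of_nonneg_right (Finset.sum_le_sum fun τ _ => ?_) hZ₂.le
    exact mul_le_mul_of_nonneg_left (hf (glue_fixed_mono_bc Λ hη τ))
      (fieldWeight_pos G Λ β h _ τ).le
  -- Step 2: the left-hand side is `⟨f R⟩^{η₁} / ⟨R⟩^{η₁}`
  have hfR : fieldExpect G Λ β h (.fixed η₁) (fun σ => f σ * R σ) =
      (∑ τ : Λ → ℤˣ, fieldWeight G Λ β h (.fixed η₂) τ * f (glue Λ τ (.fixed η₁))) /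
        fieldZ G Λ β h (.fixed η₁) := by
    rw [fieldExpect_eq_sum_div G Λ β h _ (f := fun σ => f σ * R σ) (hfm.mul hR)]
    congr 1
    refine Finset.sum_congr rfl fun τ _ => ?_
    rw [fieldWeight_fixed_eq_mul_bcTiltFactor G Λ β h η₁ η₂ τ]
    ring
  have hRexp : fieldExpect G Λ β h (.fixed η₁) R =
      fieldZ G Λ β h (.fixed η₂) / fieldZ G Λ β h (.fixed η₁) := fieldExpect_bcTiltFactor G Λ β h η₁ η₂
  have hRexp_pos : 0 < fieldExpect G Λ β h (.fixed η₁) R := by rw [hRexp]; exact div_pos hZ₂ hZ₁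
  have step2 : (∑ τ : Λ → ℤˣ, fieldWeight G Λ β h (.fixed η₂) τ * f (glue Λ τ (.fixed η₁))) /
      fieldZ G Λ β h (.fixed η₂) =
        fieldExpect G Λ β h (.fixed η₁) (fun σ => f σ * R σ) / fieldExpect G Λ β h (.fixed η₁) R := by
    rw [hfR, hRexp, div_div_div_cancel_right₀ hZ₁.ne']
  have step3 : fieldExpect G Λ β h (.fixed η₁) f ≤
      fieldExpect G Λ β h (.fixed η₁) (fun σ => f σ * R σ) / fieldExpect G Λ β h (.fixed η₁) R := by
    rw [le_div_iff₀ hRexp_pos]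
    exact field_fkg G hβ Λ h (.fixed η₁) f R hf hRmono hfm hR
  calc fieldExpect G Λ β h (.fixed η₁) f
      ≤ fieldExpect G Λ β h (.fixed η₁) (fun σ => f σ * R σ) / fieldExpect G Λ β h (.fixed η₁) R := step3
    _ = (∑ τ : Λ → ℤˣ, fieldWeight G Λ β h (.fixed η₂) τ * f (glue Λ τ (.fixed η₁))) /
          fieldZ G Λ β h (.fixed η₂) := step2.symm
    _ ≤ fieldExpect G Λ β h (.fixed η₂) f := step1

/-- The `+` boundary condition is maximal: `⟨f⟩^{η}_{Λ;β,h} ≤ ⟨f⟩^{+}_{Λ;β,h}`.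
[cite: FriedliVelenik2017, Lemma 3.23] -/
theorem fieldExpect_fixed_le_plus {β : ℝ} (hβ : 0 ≤ β) (Λ : Finset V) (h : V → ℝ)
    (η : SpinConfig V) {f : SpinConfig V → ℝ} (hf : Monotone f) (hfm : Measurable f) :
    fieldExpect G Λ β h (.fixed η) f ≤ fieldExpect G Λ β h .plus f :=
  fieldExpect_fixed_mono G hβ Λ h (fun x => intUnits_le_one (η x)) hf hfm

/-- The `-` boundary condition is minimal: `⟨f⟩^{-}_{Λ;β,h} ≤ ⟨f⟩^{η}_{Λ;β,h}`.
[cite: FriedliVelenik2017, Lemma 3.23] -/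
theorem fieldExpect_minus_le_fixed {β : ℝ} (hβ : 0 ≤ β) (Λ : Finset V) (h : V → ℝ)
    (η : SpinConfig V) {f : SpinConfig V → ℝ} (hf : Monotone f) (hfm : Measurable f) :
    fieldExpect G Λ β h .minus f ≤ fieldExpect G Λ β h (.fixed η) f :=
  fieldExpect_fixed_mono G hβ Λ h (fun x => neg_one_le_intUnits (η x)) hf hfm

end Literature.Probability.LatticeModels

end
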